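import Summits.AtomisticToContinuum.BoseEinsteinCondensation.Theorems.BECSubharmonicContinuationCoreDeficitBoundsKernelTent
import Literature.Analysis.FluidPDE.CylindricalIntegration
import Literature.Analysis.FluidPDE.NewtonPotentialHolder
import Mathlib.Analysis.InnerProductSpace.Projection.Reflection
import Mathlib.MeasureTheory.Measure.Lebesgue.VolumeOfBalls
import HarnessLib

/-!
# Route `BECSubharmonicContinuation`, support `CoreDeficitBounds` (stmt-AtomisticToContinuum-9004) —
# helper: the truncated Newton kernel identity on `ℝ³`

For `k ∈ ℝ³` and `R > 0`,

`∫_{B(0,R)} cos(∑ⱼ kⱼyⱼ) / ‖y‖ dy = 2π R² sinc²(‖k‖R/2)`, i.e.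
`‖k‖² · (4π)⁻¹ ∫_{B(0,R)} cos(k·y)/‖y‖ dy = 1 - cos(‖k‖R)`

(`integral_ball_cos_div_norm`, `norm_sq_mul_integral_ball_cos_div_norm`): the Fourier multiplier
of the core potential `(4π)⁻¹∫_{B_R} H/|y|`. Proof: a Householder reflection turns `k` onto the
axis `‖k‖e₂` (Mathlib `reflection_sub`, Lebesgue measure is invariant); in cylindrical variables
(`Literature.Analysis.FluidPDE.cylSplit`, Fubini, planar polar coordinates
`integral_fun_norm_two`) the horizontal integral of `1/‖y‖` over the disc of radius `√(R²-t²)`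
is `2π(R - |t|)`, and the remaining axial integral `2π∫(R-|t|)₊cos(κt)dt = 2πR² sinc²(κR/2)` is the
Fejér integral of the `KernelTent` file. Also `∫_{B(0,R)} dy/‖y‖ = 2πR²` and integrability.
-/

noncomputable section

open MeasureTheory Set Real Metric
open scoped BigOperators RealInnerProductSpace

namespace Summit.AtomisticToContinuum.BoseEinsteinCondensation.Theorems.CoreDeficitBounds

open Literature.Analysis.FluidPDE

open Literature.MathematicalPhysics.QuantumManyBody.BoseGas (Space)

/-! ### The Newton kernel on a ball -/

/-- The unit ball of `ℝ³` has volume `4π/3`. -/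
theorem volume_real_ball_one : (volume : Measure Space).real (ball 0 1) = 4 * π / 3 := by
  rw [Measure.real, EuclideanSpace.volume_ball_fin_three]
  rw [ENNReal.ofReal_one, one_pow, one_mul, ENNReal.toReal_ofReal (by positivity)]
  ring

/-- `1/‖y‖` is integrable on every ball of `ℝ³`. -/
theorem integrableOn_inv_norm_ball (R : ℝ) : IntegrableOn (fun y : Space => ‖y‖⁻¹) (ball 0 R) := by
  have h := NewtonPotentialHolder.integrableOn_ball_norm_rpow_neg (s := 1) (by norm_num) R
  refine h.congr_fun (fun y _ => ?_) measurableSet_ball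
  simp [Real.rpow_neg_one]

/-- **The Newton kernel of a ball at its centre**: `∫_{B(0,R)} dy/‖y‖ = 2πR²`. -/
theorem integral_inv_norm_ball {R : ℝ} (hR : 0 < R) :
    ∫ y in ball (0 : Space) R, ‖y‖⁻¹ = 2 * π * R ^ 2 := by
  have h := NewtonPotentialHolder.integral_ball_norm_rpow_neg (s := 1) (by norm_num) hR
  rw [setIntegral_congr_fun measurableSet_ball (fun y _ => (Real.rpow_neg_one ‖y‖).symm), h,
    volume_real_ball_one, show (3 : ℝ) - 1 = 2 by norm_num, Real.rpow_two]
  ring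

/-- A bounded measurable numerator over `‖y‖` is integrable on a ball. -/
theorem integrableOn_div_norm_ball {g : Space → ℝ} (hg : Measurable g) {C : ℝ} (hC : ∀ y, |g y| ≤ C)
    (R : ℝ) : IntegrableOn (fun y : Space => g y / ‖y‖) (ball 0 R) := by
  have h1 : IntegrableOn (fun y : Space => C * ‖y‖⁻¹) (ball 0 R) :=
    (integrableOn_inv_norm_ball R).const_mul C
  refine Integrable.mono' h1 ((hg.div continuous_norm.measurable).aestronglyMeasurable)
    (Filter.Eventually.of_forall fun y => ?_)
  rw [Real.norm_eq_abs, abs_div, abs_norm, div_eq_mul_inv]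
  exact mul_le_mul_of_nonneg_right (hC y) (inv_nonneg.2 (norm_nonneg _))

/-! ### The axial case, in cylindrical variables -/

/-- The squared norm in the cylindrical variables: `‖(w₀, w₁, t)‖² = ‖w‖² + t²`. -/
theorem norm_sq_cylSplit_symm (t : ℝ) (w : EuclideanSpace ℝ (Fin 2)) : ‖cylSplit.symm (t, w)‖ ^ 2 = ‖w‖ ^ 2 + t ^ 2 := by
  rw [EuclideanSpace.real_norm_sq_eq, Fin.sum_univ_three, ← cylRadius_sq, cylRadius_cylSplit_symm,
    cylSplit_symm_apply_two]

/-- The norm in the cylindrical variables: `‖(w₀, w₁, t)‖ = √(‖w‖² + t²)`. -/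
theorem norm_cylSplit_symm (t : ℝ) (w : EuclideanSpace ℝ (Fin 2)) : ‖cylSplit.symm (t, w)‖ = Real.sqrt (‖w‖ ^ 2 + t ^ 2) := by
  rw [← norm_sq_cylSplit_symm, Real.sqrt_sq (norm_nonneg _)]

/-- **The radial integral of the horizontal slice**:
`∫₀^∞ ρ · [ρ² < R² - t²] / √(ρ² + t²) dρ = (R - |t|)₊`. -/
theorem integral_radial_slice {R : ℝ} (hR : 0 < R) (t : ℝ) :
    ∫ ρ in Ioi (0 : ℝ), ρ * (if ρ ^ 2 < R ^ 2 - t ^ 2 then (Real.sqrt (ρ ^ 2 + t ^ 2))⁻¹ else 0) =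
      max (R - |t|) 0 := by
  by_cases ht : |t| < R
  · -- the disc has radius `ρ₀ = √(R² - t²) > 0`
    have ht2 : t ^ 2 < R ^ 2 := by
      have := abs_lt.1 ht
      nlinarith [abs_nonneg t, sq_abs t]
    set ρ₀ : ℝ := Real.sqrt (R ^ 2 - t ^ 2) with hρ₀
    have hρ₀pos : 0 < ρ₀ := Real.sqrt_pos.2 (by linarith)
    have hρ₀sq : ρ₀ ^ 2 = R ^ 2 - t ^ 2 := Real.sq_sqrt (by linarith)
    rw [max_eq_left (by linarith [ht.le])]
    -- restrict to `(0, ρ₀)`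
    have hcongr : ∀ ρ ∈ Ioi (0 : ℝ),
        ρ * (if ρ ^ 2 < R ^ 2 - t ^ 2 then (Real.sqrt (ρ ^ 2 + t ^ 2))⁻¹ else 0) =
          (Iio ρ₀).indicator (fun ρ => ρ * (Real.sqrt (ρ ^ 2 + t ^ 2))⁻¹) ρ := by
      intro ρ hρ
      rw [mem_Ioi] at hρ
      by_cases h : ρ < ρ₀
      · rw [indicator_of_mem (mem_Iio.2 h), if_pos]
        rw [← hρ₀sq]
        exact pow_lt_pow_left₀ h hρ.le two_ne_zero
      · rw [indicator_of_notMem (by rwa [mem_Iio]), if_neg, mul_zero]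
        rw [← hρ₀sq, not_lt]
        exact pow_le_pow_left₀ hρ₀pos.le (not_lt.1 h) 2
    rw [setIntegral_congr_fun measurableSet_Ioi hcongr, setIntegral_indicator measurableSet_Iio,
      Ioi_inter_Iio, ← integral_Ioc_eq_integral_Ioo, ← intervalIntegral.integral_of_le hρ₀pos.le]
    -- fundamental theorem of calculus with `F(ρ) = √(ρ² + t²)`
    have hderiv : ∀ ρ ∈ Ioo (0 : ℝ) ρ₀,
        HasDerivAt (fun ρ => Real.sqrt (ρ ^ 2 + t ^ 2)) (ρ * (Real.sqrt (ρ ^ 2 + t ^ 2))⁻¹) ρ := by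
      intro ρ hρ
      have hpos : 0 < ρ ^ 2 + t ^ 2 := by nlinarith [hρ.1]
      have h1 : HasDerivAt (fun ρ : ℝ => ρ ^ 2 + t ^ 2) (2 * ρ) ρ := by
        simpa using (hasDerivAt_pow 2 ρ).add_const (t ^ 2)
      have h2 := h1.sqrt hpos.ne'
      refine h2.congr_deriv ?_
      field_simp
    have hcont : ContinuousOn (fun ρ : ℝ => Real.sqrt (ρ ^ 2 + t ^ 2)) (Icc 0 ρ₀) := by fun_prop
    have hint : IntervalIntegrable (fun ρ : ℝ => ρ * (Real.sqrt (ρ ^ 2 + t ^ 2))⁻¹) volume 0 ρ₀ := by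
      refine (intervalIntegrable_const (c := (1 : ℝ))).mono_fun' ?_ ?_
      · exact ((measurable_id.mul ((measurable_id.pow_const 2).add_const _).sqrt.inv)).aestronglyMeasurable
      · refine Filter.Eventually.of_forall fun ρ => ?_
        show ‖ρ * (Real.sqrt (ρ ^ 2 + t ^ 2))⁻¹‖ ≤ 1
        rw [Real.norm_eq_abs, abs_mul, abs_inv]
        rcases eq_or_ne (Real.sqrt (ρ ^ 2 + t ^ 2)) 0 with h0 | h0
        · rw [h0]; simp
        · have hs : |ρ| ≤ |Real.sqrt (ρ ^ 2 + t ^ 2)| := by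
            rw [abs_of_nonneg (Real.sqrt_nonneg _), ← Real.sqrt_sq_eq_abs]
            exact Real.sqrt_le_sqrt (by nlinarith)
          rw [mul_inv_le_iff₀ (abs_pos.2 h0), one_mul]
          exact hs
    rw [intervalIntegral.integral_eq_sub_of_hasDerivAt_of_le hρ₀pos.le hcont hderiv hint]
    show Real.sqrt (ρ₀ ^ 2 + t ^ 2) - Real.sqrt (0 ^ 2 + t ^ 2) = R - |t|
    rw [hρ₀sq, sub_add_cancel, Real.sqrt_sq hR.le, show (0 : ℝ) ^ 2 + t ^ 2 = t ^ 2 by ring,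
      Real.sqrt_sq_eq_abs]
  · -- empty disc
    push Not at ht
    rw [max_eq_right (by linarith)]
    refine setIntegral_eq_zero_of_forall_eq_zero fun ρ _ => ?_
    rw [if_neg, mul_zero]
    have : R ^ 2 ≤ t ^ 2 := by
      rw [← sq_abs t]; exact pow_le_pow_left₀ hR.le ht 2
    nlinarith [sq_nonneg ρ]

/-- **The horizontal slice of the truncated Newton kernel**: for fixed height `t`,
`∫_{ℝ²} [‖(w,t)‖ < R] cos(κt)/‖(w,t)‖ dw = 2π cos(κt) (R - |t|)₊`. -/
theorem integral_slice {R : ℝ} (hR : 0 < R) (κ t : ℝ) :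
    ∫ w : EuclideanSpace ℝ (Fin 2), (ball (0 : Space) R).indicator (fun z => Real.cos (κ * z 2) / ‖z‖) (cylSplit.symm (t, w)) =
      radialConst₂ * (Real.cos (κ * t) * max (R - |t|) 0) := by
  set h : ℝ → ℝ := fun ρ => if ρ ^ 2 < R ^ 2 - t ^ 2 then (Real.sqrt (ρ ^ 2 + t ^ 2))⁻¹ else 0 with hh
  have hpt : ∀ w : EuclideanSpace ℝ (Fin 2), (ball (0 : Space) R).indicator (fun z => Real.cos (κ * z 2) / ‖z‖)
      (cylSplit.symm (t, w)) = Real.cos (κ * t) * h ‖w‖ := by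
    intro w
    have hmem : cylSplit.symm (t, w) ∈ ball (0 : Space) R ↔ ‖w‖ ^ 2 < R ^ 2 - t ^ 2 := by
      rw [mem_ball_zero_iff, ← sq_lt_sq₀ (norm_nonneg _) hR.le, norm_sq_cylSplit_symm]
      constructor <;> intro h' <;> linarith
    by_cases hw : ‖w‖ ^ 2 < R ^ 2 - t ^ 2
    · rw [indicator_of_mem (hmem.2 hw), hh]
      simp only
      rw [if_pos hw, cylSplit_symm_apply_two, norm_cylSplit_symm, div_eq_mul_inv]
    · rw [indicator_of_notMem (fun h' => hw (hmem.1 h')), hh]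
      simp only
      rw [if_neg hw, mul_zero]
  simp_rw [hpt]
  rw [MeasureTheory.integral_const_mul, integral_fun_norm_two h, smul_eq_mul]
  simp_rw [smul_eq_mul]
  rw [integral_radial_slice hR t]
  ring

/-- `c₂ = 2|B₁(ℝ²)| = 2π`. -/
theorem radialConst₂_eq : radialConst₂ = 2 * π := by
  rw [radialConst₂, Measure.real, EuclideanSpace.volume_ball_fin_two, ENNReal.ofReal_one, one_pow,
    one_mul, ENNReal.toReal_ofReal Real.pi_pos.le]

/-- The integrand of the truncated Newton kernel is measurable. -/
theorem measurable_cos_axial_div_norm (κ : ℝ) : Measurable fun z : Space => Real.cos (κ * z 2) / ‖z‖ :=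
  (Real.continuous_cos.measurable.comp (measurable_const.mul
    (PiLp.continuous_apply 2 (fun _ : Fin 3 => ℝ) 2).measurable)).div continuous_norm.measurable

/-- **The axial kernel identity**: `∫_{B(0,R)} cos(κ y₂)/‖y‖ dy = 2πR² sinc²(κR/2)`. -/
theorem integral_ball_cos_axial_div_norm (κ : ℝ) {R : ℝ} (hR : 0 < R) :
    ∫ z in ball (0 : Space) R, Real.cos (κ * z 2) / ‖z‖ = 2 * π * R ^ 2 * Real.sinc (κ * R / 2) ^ 2 := by
  have hint : IntegrableOn (fun z : Space => Real.cos (κ * z 2) / ‖z‖) (ball 0 R) :=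
    integrableOn_div_norm_ball ((Real.continuous_cos.measurable.comp (measurable_const.mul
      (PiLp.continuous_apply 2 (fun _ : Fin 3 => ℝ) 2).measurable))) (fun z => Real.abs_cos_le_one _) R
  rw [← MeasureTheory.integral_indicator measurableSet_ball]
  rw [integral_eq_integral_integral_cylSplit (hint.integrable_indicator measurableSet_ball)]
  simp_rw [integral_slice hR κ]
  rw [MeasureTheory.integral_const_mul, radialConst₂_eq]
  have hresc : ∀ t : ℝ, Real.cos (κ * t) * max (R - |t|) 0 = R * (max (1 - |t| / R) 0 * Real.cos (κ * t)) := by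
    intro t
    have : max (R - |t|) 0 = R * max (1 - |t| / R) 0 := by
      rw [mul_max_of_nonneg _ _ hR.le, mul_sub, mul_one, mul_div_cancel₀ _ hR.ne', mul_zero]
    rw [this]; ring
  simp_rw [hresc]
  rw [MeasureTheory.integral_const_mul, integral_tent₁_mul_cos κ hR]
  ring

/-! ### The general case, by a reflection onto the axis -/

/-- **The truncated Newton kernel identity on `ℝ³`.** For `k ∈ ℝ³` and `R > 0`,
`∫_{B(0,R)} cos(⟨k, y⟩)/‖y‖ dy = 2πR² sinc²(‖k‖R/2)` (a Householder reflection onto the axis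
`‖k‖ e₂` and the axial identity). -/
theorem integral_ball_cos_inner_div_norm (k : Space) {R : ℝ} (hR : 0 < R) :
    ∫ y in ball (0 : Space) R, Real.cos ⟪k, y⟫ / ‖y‖ = 2 * π * R ^ 2 * Real.sinc (‖k‖ * R / 2) ^ 2 := by
  set κ : ℝ := ‖k‖ with hκ
  set v : Space := κ • EuclideanSpace.single (2 : Fin 3) (1 : ℝ) with hv
  have hnv : ‖v‖ = κ := by
    rw [hv, norm_smul, Real.norm_eq_abs, abs_of_nonneg (norm_nonneg k)]
    simp [PiLp.norm_single, hκ]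
  set U : Space ≃ₗᵢ[ℝ] Space := ((ℝ ∙ (k - v))ᗮ).reflection with hU
  have hUk : U k = v := Submodule.reflection_sub hnv.symm
  have hUv : U v = k := by rw [← hUk, hU, Submodule.reflection_reflection]
  have hmp : MeasurePreserving U volume volume := U.measurePreserving
  have hemb : MeasurableEmbedding U := U.toHomeomorph.measurableEmbedding
  have hpre : U ⁻¹' ball (0 : Space) R = ball 0 R := by
    ext z
    simp only [mem_preimage, mem_ball_zero_iff, LinearIsometryEquiv.norm_map]
  have hcv := hmp.setIntegral_preimage_emb hemb (fun y : Space => Real.cos ⟪k, y⟫ / ‖y‖) (ball 0 R)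
  rw [hpre] at hcv
  rw [← hcv]
  have hpt : ∀ z : Space, Real.cos ⟪k, U z⟫ / ‖U z‖ = Real.cos (κ * z 2) / ‖z‖ := by
    intro z
    rw [← hUv, LinearIsometryEquiv.inner_map_map, LinearIsometryEquiv.norm_map, hv,
      inner_smul_left, EuclideanSpace.inner_single_left]
    simp
  simp_rw [hpt]
  exact integral_ball_cos_axial_div_norm κ hR

/-- The phase `∑ⱼ kⱼ yⱼ` is the inner product `⟨k, y⟩`. -/
theorem sum_mul_eq_inner (k y : Space) : ∑ j, k j * y j = ⟪k, y⟫ := by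
  rw [PiLp.inner_apply]
  refine Finset.sum_congr rfl fun j _ => ?_
  simp [mul_comm]

/-- **The truncated Newton kernel identity, coordinate form**:
`∫_{B(0,R)} cos(∑ⱼ kⱼyⱼ)/‖y‖ dy = 2πR² sinc²(‖k‖R/2)`. -/
theorem integral_ball_cos_div_norm (k : Space) {R : ℝ} (hR : 0 < R) :
    ∫ y in ball (0 : Space) R, Real.cos (∑ j, k j * y j) / ‖y‖ =
      2 * π * R ^ 2 * Real.sinc (‖k‖ * R / 2) ^ 2 := by
  simp_rw [sum_mul_eq_inner]
  exact integral_ball_cos_inner_div_norm k hR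

/-- **The multiplier of the core potential**:
`‖k‖² · (4π)⁻¹ ∫_{B(0,R)} cos(∑ⱼ kⱼyⱼ)/‖y‖ dy = 1 - cos(‖k‖R)` for every `k ∈ ℝ³` (both sides
vanish at `k = 0`). -/
theorem norm_sq_mul_integral_ball_cos_div_norm (k : Space) {R : ℝ} (hR : 0 < R) :
    ‖k‖ ^ 2 * ((4 * π)⁻¹ * ∫ y in ball (0 : Space) R, Real.cos (∑ j, k j * y j) / ‖y‖) =
      1 - Real.cos (‖k‖ * R) := by
  rw [integral_ball_cos_div_norm k hR]
  rcases eq_or_ne (‖k‖ * R) 0 with h0 | h0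
  · have hk : ‖k‖ = 0 := by
      rcases mul_eq_zero.1 h0 with h | h
      · exact h
      · exact absurd h hR.ne'
    rw [hk]
    simp
  · have hk : ‖k‖ ≠ 0 := fun h => h0 (by rw [h, zero_mul])
    have hR0 : R ≠ 0 := hR.ne'
    rw [Real.sinc_of_ne_zero (div_ne_zero h0 two_ne_zero), div_pow, Real.sin_sq_eq_half_sub,
      show 2 * (‖k‖ * R / 2) = ‖k‖ * R by ring]
    field_simp
    ring

/-- **The per-mode bound behind clause (a)**:
`(4π)⁻¹ ∫_{B(0,R)} cos(∑ⱼ kⱼyⱼ)/‖y‖ dy ≤ R²/2`. -/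
theorem integral_ball_cos_div_norm_le (k : Space) {R : ℝ} (hR : 0 < R) :
    (4 * π)⁻¹ * ∫ y in ball (0 : Space) R, Real.cos (∑ j, k j * y j) / ‖y‖ ≤ R ^ 2 / 2 := by
  rw [integral_ball_cos_div_norm k hR]
  have hs : Real.sinc (‖k‖ * R / 2) ^ 2 ≤ 1 :=
    (sq_le_one_iff_abs_le_one _).2 (Real.abs_sinc_le_one _)
  have hπ : 0 < π := Real.pi_pos
  rw [show (4 * π)⁻¹ * (2 * π * R ^ 2 * Real.sinc (‖k‖ * R / 2) ^ 2) =
    R ^ 2 / 2 * Real.sinc (‖k‖ * R / 2) ^ 2 by field_simp; ring]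
  nlinarith [sq_nonneg R]

/-- **The per-mode nonnegativity**: `0 ≤ ∫_{B(0,R)} cos(∑ⱼ kⱼyⱼ)/‖y‖ dy`. -/
theorem integral_ball_cos_div_norm_nonneg (k : Space) {R : ℝ} (hR : 0 < R) :
    0 ≤ ∫ y in ball (0 : Space) R, Real.cos (∑ j, k j * y j) / ‖y‖ := by
  rw [integral_ball_cos_div_norm k hR]
  positivity

end Summit.AtomisticToContinuum.BoseEinsteinCondensation.Theorems.CoreDeficitBounds

end
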